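import Summits.ValiantsHypothesis.ValiantsHypothesis.Theses.UlrichPadded
import Literature.AlgebraicGeometry.Resolution.PowerSeriesRegularLocal

/-!
# Crux `PermHypersurfaceFactorial` (stmt-ValiantsHypothesis-5666), line `derivation-symbolic-square`
— stub 2 `stub_regular_of_pderiv_notMem`: the derivation test for regularity of a hypersurface

For a field `K`, finitely many variables `σ`, `f ∈ K[σ]` and a prime `P` of `K[σ]/(f)` with
preimage `𝔮 ⊆ K[σ]`: if some partial derivative `∂f/∂x_i` is not in `𝔮`, then the local ring
`(K[σ]/(f))_P` is a regular local ring.  This is the Jacobian criterion in its *regular*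
direction, proved by the derivation test and Matsumura's Thm. 14.2 — no smoothness theory:

* `K[σ]` is a regular ring (Mathlib instances: a field is a Dedekind domain, hence
  `IsRegularRing K`, hence `IsRegularRing (MvPolynomial σ K)` by
  `MvPolynomial.isRegularRing_of_isRegularRing`), so `R = K[σ]_𝔮` is a regular local ring;
* `f ∈ 𝔮`; if `f / 1 ∈ 𝔪_R²` then some `u ∉ 𝔮` has `u f ∈ 𝔮²`, and applying the derivation
  `D = ∂/∂x_i` (`D(𝔮²) ⊆ 𝔮`, Leibniz) gives `u · D f ∈ 𝔮`, so `D f ∈ 𝔮` — excluded; hence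
  `f / 1 ∈ 𝔪_R ∖ 𝔪_R²` and `R/(f)` is regular (Matsumura Thm. 14.2,
  `IsRegularLocalRing.quotient_span_singleton`);
* `(K[σ]/(f))_P ≅ K[σ]_𝔮/(f)` (localisation commutes with quotients).

All three steps are PROVED in the tree for an arbitrary regular ring `C`, an arbitrary
derivation `D` of `C` and an arbitrary `f ∈ C`
(`Literature/AlgebraicGeometry/Resolution/PowerSeriesRegularLocal.lean`:
`isRegularLocalRing_localization_quotient_of_forall`, `Derivation.apply_mem_of_mul_mem_sq`,
packaged contrapositively as `Derivation.apply_mem_comap_of_not_isRegularLocalRing`: *in a regular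
ring `C`, if `(C/(f))_P` is not regular then `D f ∈ 𝔮` for every derivation `D` of `C`*); the
stub is that theorem for `C = K[σ]`, `D = MvPolynomial.pderiv i`, read contrapositively.
-/

noncomputable section

namespace Summit.ValiantsHypothesis.Theorems.PermHypersurfaceFactorial

open MvPolynomial IsLocalRing Literature.Computability.AlgebraicComplexity

/-- **Stub 2 (the lever: derivation test ⇒ regularity).** For a field `K`, finitely many variables
`σ`, `f ∈ K[σ]`, and a prime `P` of `K[σ]/(f)` whose preimage `𝔮` misses some partial `∂f/∂x_i`,
the local ring `(K[σ]/(f))_P` is regular: a derivation maps `𝔮²` into `𝔮`, so `f ∉ 𝔪_𝔮²` in the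
regular local ring `K[σ]_𝔮`, hence `K[σ]_𝔮/(f) ≅ (K[σ]/(f))_P` is regular (Matsumura Thm. 14.2;
tree theorem `Derivation.apply_mem_comap_of_not_isRegularLocalRing`, contrapositively).
[cite: Matsumura1987, Thm. 14.2] -/
theorem stub_regular_of_pderiv_notMem :
    ∀ (σ K : Type) [Finite σ] [Field K] (f : MvPolynomial σ K) (i : σ)
      (P : Ideal (MvPolynomial σ K ⧸ Ideal.span {f})) [P.IsPrime],
      pderiv i f ∉ P.comap (Ideal.Quotient.mk (Ideal.span {f})) →
        IsRegularLocalRing (Localization.AtPrime P) := by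
  intro σ K _ _ f i P _ hnot
  by_contra hP
  exact hnot
    (Literature.AlgebraicGeometry.Resolution.Derivation.apply_mem_comap_of_not_isRegularLocalRing
      (pderiv i) f P hP)

end Summit.ValiantsHypothesis.Theorems.PermHypersurfaceFactorial

end
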